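import Literature.Geometry.Lorentzian.LandauLifshitzPseudotensor
import HarnessLib

/-!
# Landau–Lifshitz §96: the second derivatives cancel in `(−g) t^{μν}_LL`

The densitised Landau–Lifshitz pseudotensor is `(−g) t^{μν} = Σ_α ∂_α h^{μνα} − (−g) G^{μν}/8π`
(LL (96.5)–(96.7)); both terms on the right contain SECOND derivatives of the metric
components, and Landau–Lifshitz's theorem (96.8)/(96.9) is that they cancel, leaving a quadratic
form in the first derivatives. This file proves the cancellation as the purely algebraic
identity between the parts LINEAR in the second derivatives `T_{αβ,ρσ} = ∂_α∂_β g_{ρσ}`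
(symmetric in `(α,β)` and in `(ρ,σ)`), with `U = (g_{..})⁻¹` symmetric and `d = det (g_{..})`:

* the `T`-linear part of `Σ_{αβ} ∂_α∂_β H^{μβνα}` is
  `Σ_{αβ} (−d tr(U T_{αβ})(U^{μν}U^{βα} − U^{βν}U^{μα}) + d((UT_{αβ}U)^{μν}U^{βα}
   + U^{μν}(UT_{αβ}U)^{βα} − (UT_{αβ}U)^{βν}U^{μα} − U^{βν}(UT_{αβ}U)^{μα}))` (the first
  value-derivative of `H = −d(UU − UU)` in the direction `T_{αβ}`,
  `LandauLifshitzSuperpotentialVariation.fderiv_superpotential_const_apply`);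
* the `T`-linear part of `2d G^{μν} = 2d Σ U^{μa}U^{νb}(R_{ab} − ½ R g_{ab})` comes from the
  principal part `½ Σ U^{ij}(T_{ia,bj} + T_{ib,ja} − T_{ij,ab} − T_{ai,bj} − T_{ab,ji} + T_{aj,ib})`
  of `R_{ab}` (O'Neill's first-kind formula) and `Σ_{ab} U^{μa}U^{νb} g_{ab} = U^{μν}`;

and their sum VANISHES identically (`principalPart_cancel`). The proof expands the finitely many
sums over `Fin 4` and normalises (`ring`) after orienting the symmetries of `T` and `U`.

## References
* L. D. Landau, E. M. Lifshitz, *The Classical Theory of Fields*, 4th ed., Pergamon 1975, §96,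
  (96.5)–(96.9). [LandauLifshitz1975]
-/

open scoped BigOperators Matrix

namespace Literature.Geometry.Lorentzian

namespace LandauLifshitz

/-- **The second-derivative parts of `16π Σ_α∂_α h^{μνα}` and of `16π (−g)G^{μν}/8π` cancel**
(LL §96, the content of (96.8)/(96.9)): for a symmetric matrix `U`, a scalar `d` and an array
`T` symmetric in its first and in its last pair of indices, the `T`-linear part of
`Σ_{αβ} ∂_α∂_β H^{μβνα}` plus `2d` times the `T`-linear part of `Σ_{ab} U^{μa}U^{νb}(R_{ab} − ½Rg_{ab})`
(with `Σ U^{μa}U^{νb}g_{ab}` already replaced by `U^{μν}`) is zero.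
[cite: LandauLifshitz1975, §96 (96.8)] -/
theorem principalPart_cancel (U : Matrix (Fin 4) (Fin 4) ℝ) (T : Fin 4 → Fin 4 → Fin 4 → Fin 4 → ℝ)
    (d : ℝ) (hU : ∀ i j, U i j = U j i) (hT₁ : ∀ a b r s, T a b r s = T b a r s)
    (hT₂ : ∀ a b r s, T a b r s = T a b s r) (μ ν : Fin 4) :
    (∑ α : Fin 4, ∑ β : Fin 4,
      ((-(d * Matrix.trace (U * Matrix.of (fun ρ σ ↦ T α β ρ σ))) * (U μ ν * U β α - U β ν * U μ α) +
        d * ((U * Matrix.of (fun ρ σ ↦ T α β ρ σ) * U) μ ν * U β α +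
          U μ ν * (U * Matrix.of (fun ρ σ ↦ T α β ρ σ) * U) β α -
          (U * Matrix.of (fun ρ σ ↦ T α β ρ σ) * U) β ν * U μ α -
          U β ν * (U * Matrix.of (fun ρ σ ↦ T α β ρ σ) * U) μ α)))) +
    2 * d * ((∑ a : Fin 4, ∑ b : Fin 4, U μ a * U ν b *
      (2⁻¹ * ∑ i : Fin 4, ∑ j : Fin 4, U i j * (T i a b j + T i b j a - T i j a b - T a i b j - T a b j i + T a j i b))) -
      2⁻¹ * (∑ c : Fin 4, ∑ e : Fin 4, U c e *
        (2⁻¹ * ∑ i : Fin 4, ∑ j : Fin 4, U i j * (T i c e j + T i e j c - T i j c e - T c i e j - T c e j i + T c j i e))) *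
        U μ ν) = 0 := by
  have s10 : ∀ r s, T 1 0 r s = T 0 1 r s := fun r s ↦ hT₁ 1 0 r s
  have s20 : ∀ r s, T 2 0 r s = T 0 2 r s := fun r s ↦ hT₁ 2 0 r s
  have s21 : ∀ r s, T 2 1 r s = T 1 2 r s := fun r s ↦ hT₁ 2 1 r s
  have s30 : ∀ r s, T 3 0 r s = T 0 3 r s := fun r s ↦ hT₁ 3 0 r s
  have s31 : ∀ r s, T 3 1 r s = T 1 3 r s := fun r s ↦ hT₁ 3 1 r s
  have s32 : ∀ r s, T 3 2 r s = T 2 3 r s := fun r s ↦ hT₁ 3 2 r s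
  have t10 : ∀ a b, T a b 1 0 = T a b 0 1 := fun a b ↦ hT₂ a b 1 0
  have t20 : ∀ a b, T a b 2 0 = T a b 0 2 := fun a b ↦ hT₂ a b 2 0
  have t21 : ∀ a b, T a b 2 1 = T a b 1 2 := fun a b ↦ hT₂ a b 2 1
  have t30 : ∀ a b, T a b 3 0 = T a b 0 3 := fun a b ↦ hT₂ a b 3 0
  have t31 : ∀ a b, T a b 3 1 = T a b 1 3 := fun a b ↦ hT₂ a b 3 1
  have t32 : ∀ a b, T a b 3 2 = T a b 2 3 := fun a b ↦ hT₂ a b 3 2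
  have u10 : U 1 0 = U 0 1 := hU 1 0
  have u20 : U 2 0 = U 0 2 := hU 2 0
  have u21 : U 2 1 = U 1 2 := hU 2 1
  have u30 : U 3 0 = U 0 3 := hU 3 0
  have u31 : U 3 1 = U 1 3 := hU 3 1
  have u32 : U 3 2 = U 2 3 := hU 3 2
  have v0 : U 0 ν = U ν 0 := hU 0 ν
  have v1 : U 1 ν = U ν 1 := hU 1 ν
  have v2 : U 2 ν = U ν 2 := hU 2 ν
  have v3 : U 3 ν = U ν 3 := hU 3 ν
  simp only [Matrix.trace, Matrix.diag, Matrix.mul_apply, Matrix.of_apply, Fin.sum_univ_four]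
  simp only [s10, s20, s21, s30, s31, s32, t10, t20, t21, t30, t31, t32, u10, u20, u21, u30, u31,
    u32, v0, v1, v2, v3]
  ring

end LandauLifshitz

end Literature.Geometry.Lorentzian
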